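/-
Copyright (c) 2026 the pub-hodgecm-mathlib formalisation cell (harness21).  Prover seat hodgecm-mathlib-F0P3a-p08 (g19), 2026-09-02.  Road «S3-tree»∕«S3-ram» (LEAD F0P3a-plan (g12)
T11-41∕T11-52; owner p06 (g15)), row (e2)(b) «P-2-ram», organ «(D5)-ram AT THE CM PLACE»: ★ p847296 `TypeTwoUnitIndexAtRamifiedPlace` with its ramified BASE package
discharged from `L ∕ L⁺` itself (★ `RamifiedPlaceAntiFixedUniformizer`, ★ `RamifiedPlaceEisensteinBasis`).
-/
import Literature.NumberTheory.Rogawski1990.TypeTwoUnitIndexAtRamifiedPlace     -- ★ p847296 (this seat): `exists_integers_relIndex_units_comap_norm_eq_ramifiedPlace` ((D5)-ram)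
import Literature.NumberTheory.Automorphic.RamifiedPlaceAntiFixedUniformizer        -- ★ `exists_uniformizer_galAdicCompletionMap_complexConj_eq_neg_of_ramified`
import Literature.NumberTheory.Automorphic.RamifiedPlaceEisensteinBasis            -- ★ `exists_eq_toPlace_add_toPlace_mul`, `valued_toPlace_add_toPlace_mul`, `toPlace_add_toPlace_mul_mem_integer_iff`, `valued_toPlace_eq_sq_of_ramified`
import HarnessLib

/-!
# The unit index `[C : R^×]` of the type-(2) order at a tamely RAMIFIED CM place — the (D5)-ram head with the base package discharged

Topic `NumberTheory/Rogawski1990`; namespace `Literature.NumberTheory.Rogawski1990`.  THEOREMS ONLY (no definition, no instance, no notation, no named fact, no `sorry`);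
kernel lane `--supports stmt-HodgeConjecture-24833`.  Cell `pub/hodgecm-mathlib` (D-0151), crux H413; road «S3-tree», seeding wave «S3-ram» (tame-ramified non-split `v ∤ 2`),
row (e2)(b) «P-2-ram» — the «[T2-c]-ram» unit index consumed by the R2²-ram one-place row (ramified twin of ★ `DepthZeroKappaTransferTypeTwoRowTwoPlace`).
HONEST LABEL: HC_CM is proved only modulo the 2 remaining named inputs (hLiu418 24832, h413 24833) until rung 0 closes; unconditional local algebra, count-neutral.

THE MATHEMATICS.  ★ p847296 `exists_integers_relIndex_units_comap_norm_eq_ramifiedPlace` computes `[C : R^×]` for the type-(2) order `R = 𝒪_{E_w}[(u, λ)] ≤ 𝒪_{E_w} × 𝒪_K`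
(`K = M_{w₁} = E_w(√ε₀)` UNRAMIFIED over `E_w`, `E_w ∕ F_v` tamely RAMIFIED): `2·q^{(N+n−1)∕2}` (torus type A, `s̃ θ = θ`, `N + n` odd) resp. `(q+1)·q^{(N+n−2)∕2}` (type B,
`s̃ θ = −θ`, `N + n` even), `q = #𝓀_v`.  It takes as hypotheses (R) the ramified Eisenstein package `(k₀, ϖE)` of `E_w ∕ F_v` — `|k₀|_v = exp(−1)`, `ϖE² = ι k₀`, `σ_w ϖE = −ϖE`,
unique coordinates `z = ι p + ι q·ϖE`, integrality iff `p, q ∈ 𝒪_v` — and (U) the unramified package of `K`.  At a CM place `w ∣ v ∤ 2` of `L ∕ L⁺` ramified in `L`, (R) is a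
THEOREM: ★ `exists_uniformizer_galAdicCompletionMap_complexConj_eq_neg_of_ramified` gives an anti-fixed uniformiser `ϖE` (residual triviality of `σ_w`, `|2| = 1`); writing
`ϖE² = ι p + ι q·ϖE` in the Eisenstein basis of ★ `RamifiedPlaceEisensteinBasis` and applying `σ_w` (`σ_w` fixes `ι`, negates `ϖE`) gives `2·ι q·ϖE = 0`, so `q = 0` and
`ϖE² = ι k₀` with `|k₀|_v² = |ϖE|² = exp(−2)`; uniqueness of coordinates is the valuation formula `|ι p + ι q ϖE| = max(|p|², |q|²·exp(−1))` applied to a vanishing combination.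

* §1 **`exists_antiFixed_eisenstein_package`** — (R) at a tamely ramified CM place: `∃ k₀ ϖE`, `|k₀| = exp(−1)`, `ϖE² = ι k₀`, `σ_w ϖE = −ϖE`, `∀ z, ∃! (p,q), z = ι p + ι q ϖE`,
  `ι p + ι q ϖE ∈ 𝒪 ↔ p, q ∈ 𝒪`.
* §2 **`exists_integers_relIndex_units_comap_norm_eq_ramifiedCMPlace`** — ★ (D5)-ram at `(F, E, c) := (L⁺, L, complexConj)` with (R) discharged by §1; the remaining binders are the
  CM place data `(w, hw, he, h2)`, the unramified package (U) of the eigen-field model `M_{w₁}` (supplied by ★ `UnramifiedQuadraticDictionary` (L1′)(L2′): `θ, hθ, hcoord, hint`,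
  `s̃` with `hs'ι hs's' hs'O`; type A `s̃ = s'`, type B `s̃ = s' ∘ ι'`), the residual non-square `ε₀` (`hns`), and the eigen-data `(u, t, D, y, e₂)` of the deep type-(2) match;
  the conclusion is ★ (D5)-ram's VERBATIM (integer avatars `ιO σO jO σ₁O uO tO yO DO e₂O lamO` with their coercion identities, then the two typed index formulas).

## References
* [Rogawski1990] J. D. Rogawski, *Automorphic Representations of Unitary Groups in Three Variables*, Annals of Math. Studies 123 (1990): §4.9 Lemma 4.9.3 p. 56, Prop. 4.9.1 (b) p. 55.
* [SerreLocalFields1979] J.-P. Serre, *Local Fields*, GTM 67 (1979): Ch. I §6 Prop. 18 (Eisenstein basis), Ch. IV §2 Prop. 5, Ch. V §3.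
* [Neukirch1999] J. Neukirch, *Algebraic Number Theory*, Grundlehren 322 (1999): Ch. II (6.8)–(6.9), Ch. I §12.
-/

set_option autoImplicit false

noncomputable section

open ValuativeRel NumberField IsDedekindDomain Polynomial
open scoped ValuativeRel
open Literature.NumberTheory.Automorphic Literature.NumberTheory.Automorphic.UnitaryGroup

namespace Literature.NumberTheory.Rogawski1990

variable (L : Type) [Field L] [NumberField L] [IsCMField L]

/-! ## §1 The anti-fixed Eisenstein package at a tamely ramified CM place -/

/-- **(R) THE ANTI-FIXED EISENSTEIN PACKAGE** at a place `w ∣ v` of the CM extension `L ∕ L⁺` ramified in `L` with `|2|_w = 1`: a uniformiser `k₀` of `L⁺_v` and an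
anti-fixed square root `ϖE` of `ι k₀` in `L_w` (`σ_w ϖE = −ϖE`) such that `(1, ϖE)` is an `ι(L⁺_v)`-basis of `L_w` with UNIQUE coordinates and `𝒪[L_w] = 𝒪_v ⊕ 𝒪_v·ϖE`.
[cite: SerreLocalFields1979, Ch. I §6 Prop. 18; Ch. IV §2 Prop. 5] [cite: Neukirch1999, Ch. II (6.8)–(6.9)] -/
theorem exists_antiFixed_eisenstein_package
    {v : HeightOneSpectrum (𝓞 ↥(maximalRealSubfield L))} (w : PlacesOver L v) (hw : IsCMField.complexConj L • w.1 = w.1)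
    (he : v.asIdeal.ramificationIdx' w.1.asIdeal ≠ 1) (h2 : Valued.v (2 : w.1.adicCompletion L) = 1) :
    ∃ (k₀ : v.adicCompletion ↥(maximalRealSubfield L)) (ϖE : w.1.adicCompletion L),
      Valued.v k₀ = WithZero.exp (-1 : ℤ) ∧ ϖE ^ 2 = toPlace v w k₀ ∧
      galAdicCompletionMap (L := L) (IsCMField.complexConj L) hw ϖE = -ϖE ∧
      (∀ z : w.1.adicCompletion L, ∃! pq : v.adicCompletion ↥(maximalRealSubfield L) × v.adicCompletion ↥(maximalRealSubfield L),
        z = toPlace v w pq.1 + toPlace v w pq.2 * ϖE) ∧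
      (∀ p q : v.adicCompletion ↥(maximalRealSubfield L),
        toPlace v w p + toPlace v w q * ϖE ∈ 𝒪[w.1.adicCompletion L] ↔
          p ∈ 𝒪[v.adicCompletion ↥(maximalRealSubfield L)] ∧ q ∈ 𝒪[v.adicCompletion ↥(maximalRealSubfield L)]) := by
  obtain ⟨ϖ, hϖv, hσϖ⟩ := exists_uniformizer_galAdicCompletionMap_complexConj_eq_neg_of_ramified L w hw he h2
  have hιinj : Function.Injective (toPlace v w) := (toPlace v w).injective
  -- the coordinates of `ϖ²`; applying `σ_w` kills the `ϖ`-coordinate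
  obtain ⟨p, q, hpq⟩ := exists_eq_toPlace_add_toPlace_mul L v w hw he hϖv ((ϖ : w.1.adicCompletion L) ^ 2)
  have hσsq : galAdicCompletionMap (L := L) (IsCMField.complexConj L) hw (((ϖ : w.1.adicCompletion L)) ^ 2) = (ϖ : w.1.adicCompletion L) ^ 2 := by
    rw [map_pow, hσϖ, neg_sq]
  rw [hpq, galAdicCompletionMap_toPlace_add_toPlace_mul, hσϖ] at hσsq
  have h20 : (2 : w.1.adicCompletion L) ≠ 0 := fun h => by rw [h, map_zero] at h2; exact zero_ne_one h2
  have hϖ0 : (ϖ : w.1.adicCompletion L) ≠ 0 := ϖ.ne_zero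
  have hq0 : q = 0 := by
    have h : toPlace v w q * (2 * (ϖ : w.1.adicCompletion L)) = 0 := by linear_combination -hσsq
    rcases mul_eq_zero.1 h with h | h
    · exact (map_eq_zero_iff _ hιinj).1 h
    · exact absurd h (mul_ne_zero h20 hϖ0)
  rw [hq0, map_zero, zero_mul, add_zero] at hpq
  refine ⟨p, ϖ, ?_, hpq, hσϖ, fun z => ?_, toPlace_add_toPlace_mul_mem_integer_iff L v w hw he hϖv⟩
  · -- `|p|² = |ϖ²| = exp(−2)`, so `|p| = exp(−1)`
    have h1 : Valued.v p ^ 2 = WithZero.exp (-2 : ℤ) := by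
      rw [← valued_toPlace_eq_sq_of_ramified L v w hw he p, ← hpq, map_pow, hϖv, ← WithZero.exp_nsmul]; norm_num
    have hp0 : Valued.v p ≠ 0 := fun h => by rw [h, zero_pow two_ne_zero] at h1; exact (WithZero.coe_ne_zero).symm h1
    rw [← WithZero.exp_log hp0] at h1 ⊢
    rw [← WithZero.exp_nsmul, WithZero.exp_inj] at h1
    rw [WithZero.exp_inj]
    simp only [nsmul_eq_mul, Nat.cast_ofNat] at h1
    omega
  · -- existence and uniqueness of coordinates
    obtain ⟨a, b, hab⟩ := exists_eq_toPlace_add_toPlace_mul L v w hw he hϖv z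
    refine ⟨(a, b), hab, fun pq hpq2 => ?_⟩
    have h0 : toPlace v w (pq.1 - a) + toPlace v w (pq.2 - b) * (ϖ : w.1.adicCompletion L) = 0 := by
      rw [map_sub, map_sub]; linear_combination hab - hpq2
    have hv := valued_toPlace_add_toPlace_mul L v w hw he hϖv (pq.1 - a) (pq.2 - b)
    rw [h0, map_zero] at hv
    have ha : Valued.v (pq.1 - a) ^ 2 = 0 := le_antisymm (by rw [hv]; exact le_max_left _ _) zero_le
    have hb : Valued.v (pq.2 - b) ^ 2 * WithZero.exp (-1 : ℤ) = 0 :=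
      le_antisymm (by rw [hv]; exact le_max_right _ _) zero_le
    rw [pow_eq_zero_iff two_ne_zero, map_eq_zero, sub_eq_zero] at ha
    rw [mul_eq_zero, pow_eq_zero_iff two_ne_zero, map_eq_zero, sub_eq_zero] at hb
    rcases hb with hb | hb
    · exact Prod.ext ha hb
    · exact absurd hb WithZero.coe_ne_zero

/-! ## §2 The (D5)-ram head at the CM place -/

set_option maxHeartbeats 8000000 in
/-- **(D5)-ram AT A TAMELY RAMIFIED CM PLACE** — ★ `exists_integers_relIndex_units_comap_norm_eq_ramifiedPlace` at `(F, E, c) := (L⁺, L, complexConj)` with the ramified base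
package (R) discharged by §1; see the module docstring for the remaining binders and the VERBATIM conclusion.
[cite: Rogawski1990, §4.9 Lemma 4.9.3 p. 56; Prop. 4.9.1 (b) p. 55] [cite: SerreLocalFields1979, Ch. V §3 Prop. 5 and Cor. 2; Ch. I §6 Prop. 18] [cite: Neukirch1999, Ch. I §12] -/
theorem exists_integers_relIndex_units_comap_norm_eq_ramifiedCMPlace
    {v : HeightOneSpectrum (𝓞 ↥(maximalRealSubfield L))} (w : PlacesOver L v) (hw : IsCMField.complexConj L • w.1 = w.1)
    (he : v.asIdeal.ramificationIdx' w.1.asIdeal ≠ 1) (h2 : Valued.v (2 : w.1.adicCompletion L) = 1)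
    -- (U) the unramified eigen-field `K = M_{w₁} = L_w(√ε₀)` and its package (★ `UnramifiedQuadraticDictionary` (L1′)(L2′) supply it)
    {M : Type} [Field M] [NumberField M] [Algebra L M] (w₁ : PlacesOver M w.1)
    {ε₀ : v.adicCompletion ↥(maximalRealSubfield L)} (hns : ∀ b : w.1.adicCompletion L, Valued.v b ≤ 1 → Valued.v (b * b - toPlace v w ε₀) = 1)
    {θ : w₁.1.adicCompletion M} (s' : w₁.1.adicCompletion M →+* w₁.1.adicCompletion M)
    (hθ : θ ^ 2 = toPlace w.1 w₁ (toPlace v w ε₀))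
    (hcoord : ∀ z : w₁.1.adicCompletion M, ∃! pq : w.1.adicCompletion L × w.1.adicCompletion L, z = toPlace w.1 w₁ pq.1 + toPlace w.1 w₁ pq.2 * θ)
    (hint : ∀ p q : w.1.adicCompletion L, toPlace w.1 w₁ p + toPlace w.1 w₁ q * θ ∈ 𝒪[w₁.1.adicCompletion M] ↔ p ∈ 𝒪[w.1.adicCompletion L] ∧ q ∈ 𝒪[w.1.adicCompletion L])
    (hs'ι : ∀ x, s' (toPlace w.1 w₁ x) = toPlace w.1 w₁ (galAdicCompletionMap (L := L) (IsCMField.complexConj L) hw x)) (hs's' : ∀ z, s' (s' z) = z)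
    (hs'O : ∀ z : 𝒪[w₁.1.adicCompletion M], s' z ∈ 𝒪[w₁.1.adicCompletion M])
    -- the type-(2) eigen-data of a deep match
    (u t D y e₂ : w.1.adicCompletion L) (hu1 : Valued.v (u - 1) < 1) (ht2 : Valued.v (t - 2) < 1) (h2e : e₂ * 2 = 1)
    (hD : 4 * D = t * t - y * y * toPlace v w ε₀) (hDv : Valued.v D = 1)
    (hσu : u * galAdicCompletionMap (L := L) (IsCMField.complexConj L) hw u = 1)
    (hlam1 : ((toPlace w.1 w₁ t + toPlace w.1 w₁ y * θ) * toPlace w.1 w₁ e₂) * s' ((toPlace w.1 w₁ t + toPlace w.1 w₁ y * θ) * toPlace w.1 w₁ e₂) = 1)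
    {n N : ℕ} (hn : Valued.v (u * u - t * u + D) = WithZero.exp (-(n : ℤ))) (hN : Valued.v y = WithZero.exp (-(N : ℤ))) (hN1 : 1 ≤ N) (hNn : 2 ≤ N + n) :
    ∃ (ιO : 𝒪[v.adicCompletion ↥(maximalRealSubfield L)] →+* 𝒪[w.1.adicCompletion L]) (σO : 𝒪[w.1.adicCompletion L] →+* 𝒪[w.1.adicCompletion L]) (jO : 𝒪[w.1.adicCompletion L] →+* 𝒪[w₁.1.adicCompletion M]) (σ₁O : 𝒪[w₁.1.adicCompletion M] →+* 𝒪[w₁.1.adicCompletion M])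
      (uO tO yO DO e₂O : 𝒪[w.1.adicCompletion L]) (lamO : 𝒪[w₁.1.adicCompletion M]),
      (∀ x : 𝒪[v.adicCompletion ↥(maximalRealSubfield L)], ((ιO x : 𝒪[w.1.adicCompletion L]) : w.1.adicCompletion L) = toPlace v w x) ∧
      (∀ x : 𝒪[w.1.adicCompletion L], ((σO x : 𝒪[w.1.adicCompletion L]) : w.1.adicCompletion L) = galAdicCompletionMap (L := L) (IsCMField.complexConj L) hw x) ∧
      (∀ x : 𝒪[w.1.adicCompletion L], ((jO x : 𝒪[w₁.1.adicCompletion M]) : w₁.1.adicCompletion M) = toPlace w.1 w₁ x) ∧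
      (∀ z : 𝒪[w₁.1.adicCompletion M], ((σ₁O z : 𝒪[w₁.1.adicCompletion M]) : w₁.1.adicCompletion M) = s' z) ∧
      (uO : w.1.adicCompletion L) = u ∧ (tO : w.1.adicCompletion L) = t ∧ (yO : w.1.adicCompletion L) = y ∧ (DO : w.1.adicCompletion L) = D ∧ (e₂O : w.1.adicCompletion L) = e₂ ∧
      (lamO : w₁.1.adicCompletion M) = (toPlace w.1 w₁ t + toPlace w.1 w₁ y * θ) * toPlace w.1 w₁ e₂ ∧
      (s' θ = θ → Odd (N + n) →
        (Units.map ((Polynomial.eval₂RingHom (RingHom.prod (RingHom.id 𝒪[w.1.adicCompletion L]) jO) ((uO, lamO) : 𝒪[w.1.adicCompletion L] × 𝒪[w₁.1.adicCompletion M])).range.subtype :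
            (Polynomial.eval₂RingHom (RingHom.prod (RingHom.id 𝒪[w.1.adicCompletion L]) jO) ((uO, lamO) : 𝒪[w.1.adicCompletion L] × 𝒪[w₁.1.adicCompletion M])).range →* 𝒪[w.1.adicCompletion L] × 𝒪[w₁.1.adicCompletion M])).range.relIndex
          ((Units.map ((Polynomial.eval₂RingHom (RingHom.prod (RingHom.id 𝒪[w.1.adicCompletion L]) jO) ((uO, lamO) : 𝒪[w.1.adicCompletion L] × 𝒪[w₁.1.adicCompletion M])).range.subtype :
            (Polynomial.eval₂RingHom (RingHom.prod (RingHom.id 𝒪[w.1.adicCompletion L]) jO) ((uO, lamO) : 𝒪[w.1.adicCompletion L] × 𝒪[w₁.1.adicCompletion M])).range →* 𝒪[w.1.adicCompletion L] × 𝒪[w₁.1.adicCompletion M])).range.comap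
            (MonoidHom.id (𝒪[w.1.adicCompletion L] × 𝒪[w₁.1.adicCompletion M])ˣ * Units.map (RingHom.prodMap σO σ₁O : 𝒪[w.1.adicCompletion L] × 𝒪[w₁.1.adicCompletion M] →* 𝒪[w.1.adicCompletion L] × 𝒪[w₁.1.adicCompletion M]))) =
          2 * Ideal.absNorm v.asIdeal ^ ((N + n - 1) / 2)) ∧
      (s' θ = -θ → Even (N + n) →
        (Units.map ((Polynomial.eval₂RingHom (RingHom.prod (RingHom.id 𝒪[w.1.adicCompletion L]) jO) ((uO, lamO) : 𝒪[w.1.adicCompletion L] × 𝒪[w₁.1.adicCompletion M])).range.subtype :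
            (Polynomial.eval₂RingHom (RingHom.prod (RingHom.id 𝒪[w.1.adicCompletion L]) jO) ((uO, lamO) : 𝒪[w.1.adicCompletion L] × 𝒪[w₁.1.adicCompletion M])).range →* 𝒪[w.1.adicCompletion L] × 𝒪[w₁.1.adicCompletion M])).range.relIndex
          ((Units.map ((Polynomial.eval₂RingHom (RingHom.prod (RingHom.id 𝒪[w.1.adicCompletion L]) jO) ((uO, lamO) : 𝒪[w.1.adicCompletion L] × 𝒪[w₁.1.adicCompletion M])).range.subtype :
            (Polynomial.eval₂RingHom (RingHom.prod (RingHom.id 𝒪[w.1.adicCompletion L]) jO) ((uO, lamO) : 𝒪[w.1.adicCompletion L] × 𝒪[w₁.1.adicCompletion M])).range →* 𝒪[w.1.adicCompletion L] × 𝒪[w₁.1.adicCompletion M])).range.comap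
            (MonoidHom.id (𝒪[w.1.adicCompletion L] × 𝒪[w₁.1.adicCompletion M])ˣ * Units.map (RingHom.prodMap σO σ₁O : 𝒪[w.1.adicCompletion L] × 𝒪[w₁.1.adicCompletion M] →* 𝒪[w.1.adicCompletion L] × 𝒪[w₁.1.adicCompletion M]))) =
          (Ideal.absNorm v.asIdeal + 1) * Ideal.absNorm v.asIdeal ^ ((N + n - 2) / 2)) := by
  obtain ⟨k₀, ϖE, hk₀, hϖE, hσϖE, hcoordE, hintE⟩ := exists_antiFixed_eisenstein_package L w hw he h2
  exact exists_integers_relIndex_units_comap_norm_eq_ramifiedPlace (IsCMField.complexConj L) v (IsCMField.complexConj_ne_one L) w hw he h2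
    hk₀ hϖE hσϖE hcoordE hintE w₁ hns s' hθ hcoord hint hs'ι hs's' hs'O u t D y e₂ hu1 ht2 h2e hD hDv hσu hlam1 hn hN hN1 hNn

end Literature.NumberTheory.Rogawski1990

end
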